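import Summits.HodgeConjecture.HodgeConjecture.Theorems.EquidimExistsThickPiece   -- ★ H0 p740155: `dimH_image_le_of_differentiableOn`, `dimH_range_coordUHS`, imports of record
import HarnessLib

/-!
# E-road brick H0 PER LABEL: a thick smooth piece of `𝓜_ℂ` carrying an `r`-admissible point

Cell hodgecm-mathlib, seat B-p13 (g16); B-plan1 (g14) ruling 2026-08-29 20:33:38Z («H0 goes PER LABEL»: a
`HeckeLinked` pair lives over ONE label `c ∈ (ℤ/N)ˣ`, so socket (A) needs the thick piece AT the reading `r_c`).
PROOF lane (`--as helper`).  This is the `r`-edition of ★ `EquidimThickPiece.exists_openPiece_le` (p740155, the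
`r = 1` instance of its own proof), with the witness point KEPT in the conclusion:

* `exists_openPiece_le_at` — for any principal `r ∈ K_δ(1)` with U-a at `r`, some smooth open piece of relative
  dimension `≥ g(g+1)/2` carries a `ℂ`-point classified by an `r`-admissible triple;
* `exists_openPiece_le_label` — the same for every label `c : (ZMod N)ˣ` and principal representative
  `r = diag(1, u·1)` of `c` (the four (U3) binders verbatim), U-a discharged by ★ `UHead.Ua_holds_of_residual`
  over M13 ★ `Motives.AbelianVariety.U_a3_residual_of_M13`.

References: [Mattila1995, Thm. 7.5]; [Milne2005ShimuraVarieties, §6 Thm. 6.11 pp. 74–75, Lemma 5.13 p. 57];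
[MumfordFogartyKirwan1994, Appendix to Ch. 7 §A (p. 235)].
-/

set_option autoImplicit false
set_option linter.dupNamespace false  -- `Summit.HodgeConjecture.HodgeConjecture.…` is the cell's layout (D-0017)

noncomputable section

open CategoryTheory CategoryTheory.Limits AlgebraicGeometry Matrix Topology Set
open scoped ENNReal Matrix.Norms.Elementwise
open Literature.AlgebraicGeometry
open Literature.AlgebraicGeometry.Motives (SchemeOver ComplexPoints AlgPoints specOver)
open Literature.AlgebraicGeometry.AbelianSchemes (PolarizedAbelianSchemeWithLevel)
open Literature.AlgebraicGeometry.HodgeTheory (IsQuasiProjectiveOver)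
open Literature.AlgebraicGeometry.ModuliOfAbelianVarieties
open Literature.NumberTheory.Automorphic (siegelUpperHalfSpace)
open Literature.NumberTheory.ModularForms.SiegelUpperHalfSpace

namespace Summit.HodgeConjecture.HodgeConjecture.Theorems

namespace EquidimThickPiece

open SiegelModuli

/-- **H0 AT A READING `r` («∃ thick piece carrying an `r`-admissible point»).**  For a principal representative
`r ∈ K_δ(1)` such that every `Z ∈ 𝔥_g` is the period point at `r` of some triple (`hUa`, U-a at `r`: ★
`UHead.Ua_holds_of_residual` at `(c, u, r)`), SOME smooth open piece `S′ ↪ 𝓜_ℂ` has relative dimension `≥ g(g+1)/2`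
AND carries a `ℂ`-point `t` whose classifying point is that of an `r`-admissible triple `P₀` at some `Z₀` — the
witness the socket-(A) lift starts from.  Same Hausdorff count as `exists_openPiece_le` (the `r = 1` edition),
run with `Y_c^{(r)} := {t ∈ S_c(ℂ) : cls⁻¹(ι t) is r-admissible}`: if every piece meeting `Y^{(r)}` were thin, the
countably many holomorphic leaves `v ↦ sym(M • π(chart⁻¹ v))` (`M ∈ Sp_δ(ℤ)`, [Milne ISV] Lemma 5.13 at `r`, ★
`exists_siegelLevelGroup_smul_of_isAdmissibleAt`) of dimension `≤ 2d_c ≤ g(g+1) − 2` would cover `𝔥_g`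
([Mattila1995] Thm. 7.5), contradiction. [cite: Mattila1995, Thm. 7.5]
[cite: Milne2005ShimuraVarieties, §6 Thm. 6.11 pp. 74–75, Lemma 5.13 p. 57]
[cite: MumfordFogartyKirwan1994, Appendix to Ch. 7 §A (p. 235)] -/
theorem exists_openPiece_le_at (hF : lan2013_siegelFineModuliScheme)
    (hP4 : ∀ (g N : ℕ) (δ : Fin g → ℕ) (_hg : 0 < g) (hδ : IsPolarizationType δ) (_hN : 3 ≤ N)
      (𝓜 : SiegelFineModuliScheme g N δ) (r : gspFinAdelic δ)
      {S' : SchemeOver ℂ} (ι : S' ⟶ (Motives.baseChange ℚ ℂ).obj 𝓜.M) [IsOpenImmersion ι.left]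
      (_hSq : HodgeTheory.IsQuasiProjectiveOver S')
      (d : ℕ) [SmoothOfRelativeDimension d S'.hom],
      haveI : IsLocallyNoetherian (specOver ℚ ℂ).left :=
        inferInstanceAs (IsLocallyNoetherian (Spec (CommRingCat.of ℂ)))
      haveI : Smooth S'.hom := SmoothOfRelativeDimension.smooth d _
      haveI : LocallyOfFiniteType S'.hom := inferInstance
      r ∈ principalLevelSubgroup δ 1 →
      ∀ (Z₀ : Matrix (Fin g) (Fin g) ℂ) (hZ₀ : Z₀ ∈ siegelUpperHalfSpace g)
        (P₀ : PolarizedAbelianSchemeWithLevel g N δ (specOver ℚ ℂ).left), IsAdmissibleAt hδ r Z₀ hZ₀ P₀ →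
      ∀ (t₀ : ComplexPoints S'),
        AlgPoints.map (L := ℂ) ι t₀ =
          AlgPoints.baseChangeEquiv (algebraMap ℚ ℂ) 𝓜.M (𝓜.classifyingMap (specOver ℚ ℂ) P₀) →
      ∃ (W : Set (ComplexPoints S')) (π : ComplexPoints S' → Matrix (Fin g) (Fin g) ℂ),
        IsOpen W ∧ t₀ ∈ W ∧ π t₀ = Z₀ ∧ ContinuousOn π W ∧
        (∀ x ∈ W, ∀ (i j : Fin g),
          DifferentiableOn ℂ
            ((fun y ↦ π y i j) ∘ (ComplexPoints.algebraicChart S' d x).symm)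
            ((ComplexPoints.algebraicChart S' d x).target ∩ (ComplexPoints.algebraicChart S' d x).symm ⁻¹' W)) ∧
        (∀ x ∈ W, ∃ hx : π x ∈ siegelUpperHalfSpace g,
          ∃ P' : PolarizedAbelianSchemeWithLevel g N δ (specOver ℚ ℂ).left,
            IsAdmissibleAt hδ r (π x) hx P' ∧
            AlgPoints.baseChangeEquiv (algebraMap ℚ ℂ) 𝓜.M (𝓜.classifyingMap (specOver ℚ ℂ) P') = AlgPoints.map (L := ℂ) ι x))
    {g N : ℕ} {δ : Fin g → ℕ} (hg : 0 < g) (hδ : IsPolarizationType δ) (hN : 3 ≤ N)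
    (𝓜 : SiegelFineModuliScheme g N δ) {r : gspFinAdelic δ} (hr : r ∈ principalLevelSubgroup δ 1)
    (hUa : ∀ (Z : Matrix (Fin g) (Fin g) ℂ) (hZ : Z ∈ siegelUpperHalfSpace g),
      ∃ P' : PolarizedAbelianSchemeWithLevel g N δ (specOver ℚ ℂ).left, IsAdmissibleAt hδ r Z hZ P') :
    ∃ (S₀ : SchemeOver ℂ) (ι₀ : S₀ ⟶ (Motives.baseChange ℚ ℂ).obj 𝓜.M) (_ : IsOpenImmersion ι₀.left)
      (d₀ : ℕ) (_ : SmoothOfRelativeDimension d₀ S₀.hom) (t₀ : ComplexPoints S₀)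
      (Z₀ : Matrix (Fin g) (Fin g) ℂ) (hZ₀ : Z₀ ∈ siegelUpperHalfSpace g)
      (P₀ : PolarizedAbelianSchemeWithLevel g N δ (specOver ℚ ℂ).left),
      g * (g + 1) / 2 ≤ d₀ ∧ IsAdmissibleAt hδ r Z₀ hZ₀ P₀ ∧
      (haveI : IsLocallyNoetherian (specOver ℚ ℂ).left :=
        inferInstanceAs (IsLocallyNoetherian (Spec (CommRingCat.of ℂ)))
      AlgPoints.baseChangeEquiv (algebraMap ℚ ℂ) 𝓜.M (𝓜.classifyingMap (specOver ℚ ℂ) P₀) =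
        AlgPoints.map (L := ℂ) ι₀ t₀) := by
  classical
  haveI : IsLocallyNoetherian (specOver ℚ ℂ).left := inferInstanceAs (IsLocallyNoetherian (Spec (CommRingCat.of ℂ)))
  set D : ℕ := g * (g + 1) / 2 with hDdef
  obtain ⟨hMs, hMq, -⟩ := W1.smooth_qproj_of_F hF hg hδ hN 𝓜
  obtain ⟨C, hCfin, E, e, d, hopen, -, hqp, hdim, hpart, -⟩ :=
    UnivFamilyHodgeFrames.exists_smooth_pieces_baseChange_M 𝓜 hMs hMq
  haveI := hCfin
  -- the abbreviations
  let bce := AlgPoints.baseChangeEquiv (algebraMap ℚ ℂ) 𝓜.M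
  -- the set of points of a piece whose classifying point is `r`-admissible
  let Y : ∀ c, Set (ComplexPoints (E c)) := fun c ↦
    {t | ∃ (Z : Matrix (Fin g) (Fin g) ℂ) (hZ : Z ∈ siegelUpperHalfSpace g)
      (P₀ : PolarizedAbelianSchemeWithLevel g N δ (specOver ℚ ℂ).left),
        IsAdmissibleAt hδ r Z hZ P₀ ∧ AlgPoints.map (L := ℂ) (e c) t = bce (𝓜.classifyingMap (specOver ℚ ℂ) P₀)}
  by_contra hcon
  -- every piece carrying an `r`-admissible point is thin
  have hthin : ∀ c, (Y c).Nonempty → d c + 1 ≤ D := by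
    rintro c ⟨t, Z, hZ, P₀, hadm, ht⟩
    by_contra hlt
    haveI := hopen c
    exact hcon ⟨E c, e c, hopen c, d c, hdim c, t, Z, hZ, P₀, by omega, hadm, ht.symm⟩
  -- P4-piece charts around the points of `Y c`
  have hloc : ∀ (c : C) (t : Y c), ∃ (W : Set (ComplexPoints (E c)))
      (π : ComplexPoints (E c) → Matrix (Fin g) (Fin g) ℂ), IsOpen W ∧ (t : ComplexPoints (E c)) ∈ W ∧
      (haveI : Smooth (E c).hom := SmoothOfRelativeDimension.smooth (d c) _
       haveI : LocallyOfFiniteType (E c).hom := inferInstance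
       ∀ x ∈ W, ∀ (i j : Fin g), DifferentiableOn ℂ
        ((fun y ↦ π y i j) ∘ (ComplexPoints.algebraicChart (E c) (d c) x).symm)
        ((ComplexPoints.algebraicChart (E c) (d c) x).target ∩ (ComplexPoints.algebraicChart (E c) (d c) x).symm ⁻¹' W)) ∧
      (∀ x ∈ W, ∃ hx : π x ∈ siegelUpperHalfSpace g,
        ∃ P' : PolarizedAbelianSchemeWithLevel g N δ (specOver ℚ ℂ).left,
          IsAdmissibleAt hδ r (π x) hx P' ∧
          bce (𝓜.classifyingMap (specOver ℚ ℂ) P') = AlgPoints.map (L := ℂ) (e c) x) := by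
    rintro c ⟨t, Z, hZ, P₀, hadm, ht⟩
    haveI := hopen c
    haveI := hdim c
    obtain ⟨W, π, hWo, htW, -, -, hhol, hread⟩ :=
      hP4 g N δ hg hδ hN 𝓜 r (e c) (hqp c) (d c) hr Z hZ P₀ hadm t ht
    exact ⟨W, π, hWo, htW, hhol, hread⟩
  choose W π hWo htW hhol hread using hloc
  -- second countability of the pieces' complex points (quasi-projective)
  have hsc : ∀ c, SecondCountableTopology (ComplexPoints (E c)) := by
    intro c
    obtain ⟨P, j, hP, hj⟩ := hqp c
    haveI := hj
    haveI := Literature.AlgebraicGeometry.Motives.IsProjectiveOver.isProper hP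
    exact Literature.AlgebraicGeometry.Motives.ComplexPoints.secondCountableTopology_of_isOpenImmersion (E c) j
  -- countably many charts `W c t`, `t ∈ T c`, cover `Y c`
  have hT : ∀ c, ∃ T : Set (Y c), T.Countable ∧ ⋃ t ∈ T, W c t = ⋃ t, W c t := fun c ↦ by
    haveI := hsc c
    exact TopologicalSpace.isOpen_iUnion_countable (fun t : Y c ↦ W c t) (fun t ↦ hWo c t)
  choose T hTc hTU using hT
  -- countably many algebraic chart sources at points of `W c t` cover `W c t`
  have hT' : ∀ (c : C) (t : Y c), ∃ S : Set (W c t), S.Countable ∧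
      (haveI : Smooth (E c).hom := SmoothOfRelativeDimension.smooth (d c) _
       haveI : LocallyOfFiniteType (E c).hom := inferInstance
       ⋃ x ∈ S, (ComplexPoints.algebraicChart (E c) (d c) (x : ComplexPoints (E c))).source =
         ⋃ x : W c t, (ComplexPoints.algebraicChart (E c) (d c) (x : ComplexPoints (E c))).source) := by
    intro c t
    haveI := hsc c
    haveI := hdim c
    haveI : Smooth (E c).hom := SmoothOfRelativeDimension.smooth (d c) _
    haveI : LocallyOfFiniteType (E c).hom := inferInstance
    exact TopologicalSpace.isOpen_iUnion_countable
      (fun x : W c t ↦ (ComplexPoints.algebraicChart (E c) (d c) (x : ComplexPoints (E c))).source)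
      (fun x ↦ (ComplexPoints.algebraicChart (E c) (d c) (x : ComplexPoints (E c))).open_source)
  choose T' hT'c hT'U using hT'
  -- instances on the pieces
  haveI hOI : ∀ c, IsOpenImmersion (e c).left := hopen
  haveI hSRD : ∀ c, SmoothOfRelativeDimension (d c) (E c).hom := hdim
  haveI hSm : ∀ c, Smooth (E c).hom := fun c ↦ SmoothOfRelativeDimension.smooth (d c) _
  haveI hLFT : ∀ c, LocallyOfFiniteType (E c).hom := fun c ↦ inferInstance
  haveI : Countable (Matrix (Fin g ⊕ Fin g) (Fin g ⊕ Fin g) ℤ) :=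
    inferInstanceAs (Countable (Fin g ⊕ Fin g → Fin g ⊕ Fin g → ℤ))
  haveI : Countable (GL (Fin g ⊕ Fin g) ℤ) :=
    Function.Injective.countable
      (f := (Units.val : GL (Fin g ⊕ Fin g) ℤ → Matrix (Fin g ⊕ Fin g) (Fin g ⊕ Fin g) ℤ)) fun a b h ↦ Units.ext h
  -- the holomorphic maps whose images cover `𝔥_g` in Klingen's coordinates
  let Mt : symplecticLatticeGroup δ → Matrix (Fin g ⊕ Fin g) (Fin g ⊕ Fin g) ℂ := fun M ↦
    ((gDHom δ hδ.1 M : Matrix.symplecticGroup (Fin g) ℝ) : Matrix (Fin g ⊕ Fin g) (Fin g ⊕ Fin g) ℝ).map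
      ((↑) : ℝ → ℂ)
  let sym : Matrix (Fin g) (Fin g) ℂ → (Sym2 (Fin g) → ℂ) := fun Z s ↦
    Sym2.lift ⟨fun i j ↦ (2 : ℂ)⁻¹ * (Z i j + Z j i), fun i j ↦ by ring⟩ s
  let ch : ∀ c, ComplexPoints (E c) → OpenPartialHomeomorph (ComplexPoints (E c)) (Fin (d c) → ℂ) :=
    fun c x ↦ ComplexPoints.algebraicChart (E c) (d c) x
  let U : ∀ c, Y c → ComplexPoints (E c) → Set (Fin (d c) → ℂ) := fun c t x ↦
    (ch c x).target ∩ (ch c x).symm ⁻¹' W c t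
  let F : ∀ c, Y c → ComplexPoints (E c) → symplecticLatticeGroup δ → (Fin (d c) → ℂ) → (Sym2 (Fin g) → ℂ) :=
    fun c t x M v ↦ sym (moeb (Mt M) (π c t ((ch c x).symm v)))
  let 𝒮 : Set (Sym2 (Fin g) → ℂ) :=
    ⋃ c, ⋃ t : T c, ⋃ x : T' c t.1, ⋃ M : symplecticLatticeGroup δ,
      F c t.1 (x.1 : ComplexPoints (E c)) M '' U c t.1 (x.1 : ComplexPoints (E c))
  /- (B) every leaf of `𝒮` has Hausdorff dimension `≤ 2 d_c` -/
  have hleaf : ∀ (c : C) (t : Y c) (x : W c t) (M : symplecticLatticeGroup δ),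
      dimH (F c t (x : ComplexPoints (E c)) M '' U c t (x : ComplexPoints (E c))) ≤ ((2 * d c : ℕ) : ℝ≥0∞) := by
    intro c t x M
    refine dimH_image_le_of_differentiableOn ((ch c x).isOpen_inter_preimage_symm (hWo c t)) ?_
    have hG : DifferentiableOn ℂ (fun v ↦ π c t ((ch c x).symm v)) (U c t x) :=
      differentiableOn_pi.2 fun i ↦ differentiableOn_pi.2 fun j ↦ hhol c t x x.2 i j
    have hmaps : MapsTo (fun v ↦ π c t ((ch c x).symm v)) (U c t x) (siegelUpperHalfSpace g) :=
      fun v hv ↦ (hread c t _ hv.2).1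
    have hmo : DifferentiableOn ℂ (moeb (Mt M)) (siegelUpperHalfSpace g) :=
      differentiableOn_moeb_of_mem (gDHom δ hδ.1 M).2
    have hcomp := hmo.comp hG hmaps
    refine differentiableOn_pi.2 fun s ↦ ?_
    induction s using Sym2.ind with
    | _ i j =>
      have h1 := differentiableOn_pi.1 (differentiableOn_pi.1 hcomp i) j
      have h2 := differentiableOn_pi.1 (differentiableOn_pi.1 hcomp j) i
      have h3 := (h1.add h2).const_mul (2 : ℂ)⁻¹
      refine h3.congr fun v _ ↦ ?_
      simp only [F, sym, Sym2.lift_mk, Pi.add_apply, Function.comp_apply]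
  /- (A) `𝔥_g` in coordinates is covered by `𝒮` -/
  have hcover : Set.range (coordUHS : siegelUpperHalfSpace g → Sym2 (Fin g) → ℂ) ⊆ 𝒮 := by
    rintro _ ⟨z, rfl⟩
    obtain ⟨PZ, hPZ⟩ := hUa z.1 z.2
    obtain ⟨c, t₀, ht₀⟩ := hpart.exists_mem (bce (𝓜.classifyingMap (specOver ℚ ℂ) PZ))
    have hY : t₀ ∈ Y c := ⟨z.1, z.2, PZ, hPZ, ht₀⟩
    have hmemW : t₀ ∈ ⋃ t ∈ T c, W c t := by
      rw [hTU c]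
      exact Set.mem_iUnion.2 ⟨⟨t₀, hY⟩, htW c ⟨t₀, hY⟩⟩
    obtain ⟨t, htT, ht₀W⟩ := Set.mem_iUnion₂.1 hmemW
    obtain ⟨hπ, P', hP'adm, hP'cls⟩ := hread c t t₀ ht₀W
    have hcls : 𝓜.classifyingMap (specOver ℚ ℂ) PZ = 𝓜.classifyingMap (specOver ℚ ℂ) P' :=
      bce.injective (by rw [hP'cls, ht₀])
    have hPZ' : IsAdmissibleAt hδ r (π c t t₀) hπ PZ :=
      𝓜.isAdmissibleAt_of_classifyingMap_eq hδ P' PZ hP'adm hcls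
    obtain ⟨M, -, hM⟩ :=
      exists_siegelLevelGroup_smul_of_isAdmissibleAt hg hδ hN hr z.2 hπ PZ hPZ hPZ'
    have hmemS : t₀ ∈ ⋃ x ∈ T' c t, (ch c (x : ComplexPoints (E c))).source := by
      rw [hT'U c t]
      exact Set.mem_iUnion.2 ⟨⟨t₀, ht₀W⟩, ComplexPoints.mem_algebraicChart_source _ _ _⟩
    obtain ⟨x, hxT, hx⟩ := Set.mem_iUnion₂.1 hmemS
    refine Set.mem_iUnion.2 ⟨c, Set.mem_iUnion.2 ⟨⟨t, htT⟩, Set.mem_iUnion.2 ⟨⟨x, hxT⟩,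
      Set.mem_iUnion.2 ⟨M, ?_⟩⟩⟩⟩
    refine ⟨ch c x t₀, ⟨(ch c x).map_source hx, ?_⟩, ?_⟩
    · show (ch c x).symm (ch c x t₀) ∈ W c t
      rw [(ch c x).left_inv hx]
      exact ht₀W
    · have hsymm : (ch c (x : ComplexPoints (E c))).symm (ch c (x : ComplexPoints (E c)) t₀) = t₀ :=
        (ch c x).left_inv hx
      have hZ : moeb (Mt M) (π c t t₀) = (z : Matrix (Fin g) (Fin g) ℂ) := by
        have h := congrArg (fun w : siegelUpperHalfSpace g ↦ (w : Matrix (Fin g) (Fin g) ℂ)) hM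
        simpa only [coe_smul] using h.symm
      funext s
      induction s using Sym2.ind with
      | _ i j =>
        simp only [F, sym, hsymm, hZ, Sym2.lift_mk, coordUHS_apply_mk]
        rw [z.2.1.apply i j]
        ring
  /- (C) the count -/
  have hdimS : dimH 𝒮 ≤ ((2 * (g * (g + 1) / 2) - 2 : ℕ) : ℝ≥0∞) := by
    refine (dimH_iUnion _).trans_le (iSup_le fun c ↦ ?_)
    haveI := (hTc c).to_subtype
    refine (dimH_iUnion _).trans_le (iSup_le fun t ↦ ?_)
    haveI := (hT'c c t.1).to_subtype
    refine (dimH_iUnion _).trans_le (iSup_le fun x ↦ ?_)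
    refine (dimH_iUnion _).trans_le (iSup_le fun M ↦ ?_)
    refine (hleaf c t.1 x.1 M).trans ?_
    have hth := hthin c ⟨t.1.1, t.1.2⟩
    exact_mod_cast (by omega : 2 * d c ≤ 2 * (g * (g + 1) / 2) - 2)
  have hle := (dimH_mono hcover).trans hdimS
  rw [dimH_range_coordUHS] at hle
  have hnat : 2 * (g * (g + 1) / 2) ≤ 2 * (g * (g + 1) / 2) - 2 := by exact_mod_cast hle
  have h2 : 2 ≤ g * (g + 1) := by nlinarith
  generalize hk : g * (g + 1) = k at hnat h2
  omega

/-- **H0 for every label `c ∈ (ℤ/N)ˣ`.**  For a principal representative `r = diag(1, u·1)` of the label `c`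
(`u ∈ Ẑˣ`, `u ≡ c (mod N)`, `r ∈ K_δ(1)`, `ν(r) = u` — the four (U3) binders verbatim), some smooth open piece of
`𝓜_ℂ` of relative dimension `≥ g(g+1)/2` carries a `ℂ`-point classified by an `r`-admissible triple (U-a at `r`
by ★ `UHead.Ua_holds_of_residual` over M13). [cite: Mattila1995, Thm. 7.5]
[cite: Milne2005ShimuraVarieties, §6 Thm. 6.11 pp. 74–75, Lemma 5.13 p. 57] -/
theorem exists_openPiece_le_label (hF : lan2013_siegelFineModuliScheme)
    (hP4 : ∀ (g N : ℕ) (δ : Fin g → ℕ) (_hg : 0 < g) (hδ : IsPolarizationType δ) (_hN : 3 ≤ N)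
      (𝓜 : SiegelFineModuliScheme g N δ) (r : gspFinAdelic δ)
      {S' : SchemeOver ℂ} (ι : S' ⟶ (Motives.baseChange ℚ ℂ).obj 𝓜.M) [IsOpenImmersion ι.left]
      (_hSq : HodgeTheory.IsQuasiProjectiveOver S')
      (d : ℕ) [SmoothOfRelativeDimension d S'.hom],
      haveI : IsLocallyNoetherian (specOver ℚ ℂ).left :=
        inferInstanceAs (IsLocallyNoetherian (Spec (CommRingCat.of ℂ)))
      haveI : Smooth S'.hom := SmoothOfRelativeDimension.smooth d _
      haveI : LocallyOfFiniteType S'.hom := inferInstance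
      r ∈ principalLevelSubgroup δ 1 →
      ∀ (Z₀ : Matrix (Fin g) (Fin g) ℂ) (hZ₀ : Z₀ ∈ siegelUpperHalfSpace g)
        (P₀ : PolarizedAbelianSchemeWithLevel g N δ (specOver ℚ ℂ).left), IsAdmissibleAt hδ r Z₀ hZ₀ P₀ →
      ∀ (t₀ : ComplexPoints S'),
        AlgPoints.map (L := ℂ) ι t₀ =
          AlgPoints.baseChangeEquiv (algebraMap ℚ ℂ) 𝓜.M (𝓜.classifyingMap (specOver ℚ ℂ) P₀) →
      ∃ (W : Set (ComplexPoints S')) (π : ComplexPoints S' → Matrix (Fin g) (Fin g) ℂ),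
        IsOpen W ∧ t₀ ∈ W ∧ π t₀ = Z₀ ∧ ContinuousOn π W ∧
        (∀ x ∈ W, ∀ (i j : Fin g),
          DifferentiableOn ℂ
            ((fun y ↦ π y i j) ∘ (ComplexPoints.algebraicChart S' d x).symm)
            ((ComplexPoints.algebraicChart S' d x).target ∩ (ComplexPoints.algebraicChart S' d x).symm ⁻¹' W)) ∧
        (∀ x ∈ W, ∃ hx : π x ∈ siegelUpperHalfSpace g,
          ∃ P' : PolarizedAbelianSchemeWithLevel g N δ (specOver ℚ ℂ).left,
            IsAdmissibleAt hδ r (π x) hx P' ∧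
            AlgPoints.baseChangeEquiv (algebraMap ℚ ℂ) 𝓜.M (𝓜.classifyingMap (specOver ℚ ℂ) P') = AlgPoints.map (L := ℂ) ι x))
    {g N : ℕ} {δ : Fin g → ℕ} (hg : 0 < g) (hδ : IsPolarizationType δ) (hN : 3 ≤ N)
    (𝓜 : SiegelFineModuliScheme g N δ) (c : (ZMod N)ˣ) (u : finAdeleQˣ) (r : gspFinAdelic δ)
    (hu : ∀ v, Valued.v ((u : finAdeleQ) v) = 1)
    (huc : (u : finAdeleQ) - ((c : ZMod N).val : ℕ) ∈ levelIdeal N)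
    (hr : r ∈ principalLevelSubgroup δ 1)
    (hru : IsMultiplier (typeFormOver δ finAdeleQ) (r : GL (Fin g ⊕ Fin g) finAdeleQ) u)
    (hrb : ((r : GL (Fin g ⊕ Fin g) finAdeleQ) : Matrix (Fin g ⊕ Fin g) (Fin g ⊕ Fin g) finAdeleQ) =
      Matrix.fromBlocks 1 0 0 ((u : finAdeleQ) • (1 : Matrix (Fin g) (Fin g) finAdeleQ))) :
    ∃ (S₀ : SchemeOver ℂ) (ι₀ : S₀ ⟶ (Motives.baseChange ℚ ℂ).obj 𝓜.M) (_ : IsOpenImmersion ι₀.left)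
      (d₀ : ℕ) (_ : SmoothOfRelativeDimension d₀ S₀.hom) (t₀ : ComplexPoints S₀)
      (Z₀ : Matrix (Fin g) (Fin g) ℂ) (hZ₀ : Z₀ ∈ siegelUpperHalfSpace g)
      (P₀ : PolarizedAbelianSchemeWithLevel g N δ (specOver ℚ ℂ).left),
      g * (g + 1) / 2 ≤ d₀ ∧ IsAdmissibleAt hδ r Z₀ hZ₀ P₀ ∧
      (haveI : IsLocallyNoetherian (specOver ℚ ℂ).left :=
        inferInstanceAs (IsLocallyNoetherian (Spec (CommRingCat.of ℂ)))
      AlgPoints.baseChangeEquiv (algebraMap ℚ ℂ) 𝓜.M (𝓜.classifyingMap (specOver ℚ ℂ) P₀) =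
        AlgPoints.map (L := ℂ) ι₀ t₀) :=
  haveI : Fact (1 < N) := ⟨by omega⟩
  exists_openPiece_le_at hF hP4 hg hδ hN 𝓜 hr
    (UHead.Ua_holds_of_residual Motives.AbelianVariety.U_a3_residual_of_M13 g N δ hg hδ hN c u r hu huc hr hru hrb)

end EquidimThickPiece

end Summit.HodgeConjecture.HodgeConjecture.Theorems

end
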